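import Literature.Analysis.FluidPDE.ChenTsaiZhang2022LocalRegularity
import Literature.Analysis.FluidPDE.OzanskiPalasek2022AxisymWeakL3Quantitative
import Literature.Analysis.FluidPDE.SwirlMaximumPrinciple
import Literature.Analysis.FluidPDE.TaoQuantitativeClass
import Summits.NavierStokesRegularity.NavierStokesRegularity.Theorems.SwirlHolderTower
import HarnessLib

/-!
# ROUND-16 (nsreg-p2, gen 18) — `SwirlGaugedTower`: the ARGUMENT of the inner exponential

Ożański–Palasek (arXiv:2210.10030, Thm 1.1 = tree fact
`ozanskiPalasek2022_axisym_weakL3_quantitative`) bound an axisymmetric classical solution with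
`‖u‖_{L^∞_t L^{3,∞}_x} ≤ A` by `exp exp (A^{O(1)})`.  ROUND-15 located the inner exponential: it
is the FORM of the Hölder exponent `γ` of the swirl `Θ = r u^θ` at the axis in the critical frame
(`γ = exp(-C·𝒩^θ)`, `𝒩` = the critical drift gauge), entering their §7 only through the smallness
radius `r₀ = A^{-γ^{-2}}` (p. 17 L58) and the final `E(1) ≲ r₀^{-12}` (p. 18 L48–54).

ROUND-16 changes not the form but the ARGUMENT of `γ`.  Print deliberately bounds by `A` alone
(p. 6 L14: a bound through [Lei–Zhang 2017] "would contain more iterated exponentials as well as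
severe dependence on subcritical norms of the initial data").  There is exactly one further datum
quantity that is CRITICAL (scale-invariant), CONSERVED a priori (the swirl maximum principle, tree
theorem `abs_swirl_le_of_classical`) and free of `A`: the swirl Reynolds number
`R_Γ = ‖r u^θ(0)‖_∞ / ν`.  The rung of this round, `SwirlGaugedLaw`, asserts that in the
Chen–Tsai–Zhang / Ożański–Palasek frame the Hölder exponent of `Θ` at the axis depends on the
swirl OSCILLATION alone — `γ = γ₁(osc Θ) > 0` — while the critical gauge `M` enters only the
prefactor.  Consequences, by Ożański–Palasek §7 verbatim with `γ` now independent of `A`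
(`towerBound_of_constExponent`): a POLYNOMIAL bound `‖u(t)‖_∞ ≤ C(Γ₀) A^{D(Γ₀)} t^{-1/2}`
(`OzanskiPalasekPolynomial`) and a POWER-type blow-up rate of the weak-`L³` norm
(`WeakL3PowerRate`), in place of `exp exp A^{O(1)}` and `(log log)^{c}`: the threshold crossed is
log-type → power-type, which excludes every polylog-corrected Type-I axisymmetric blow-up
scenario (`polylog_scenario_excluded`; e.g. the fitted scaling of Hou, arXiv:2107.06509 §3.4).

Why the rung is Navier–Stokes-ESSENTIAL: for PASSIVE swirls (the linear class in which print
proves the Hölder step) a swirl-gauged law is VACUOUS — the class is a cone (`Θ ↦ λΘ`), so a law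
gauged by `osc Θ` is a law with a CONSTANT exponent, and ROUND-15's funnel forces that constant to
be `≤ 0` (`gaugedExponent_le_of_cone`, `gaugedExponent_nonpos_of_funnels`).  Only the coupling
`Θ ↔ u` can make `γ₁` positive; the heuristic price is the η-BUDGET of the funnel (memo §1c, kit
job j272044: a steady funnel of strength `N` needs a swirl contrast `≥ (N+2)²(13N-4)/(25N) ≥ 0.52 N²`
in units of `ν²`, so `N ≤ 1.39 R_Γ` scale by scale and `γ₁(R_Γ) ≳ e^{-0.35 R_Γ}`), whose `R_Γ = 0`
endpoint is the Ukhovskii–Yudovich mechanism (`η = ω^θ/r` obeys a maximum principle without swirl).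

Contents (all statements elaborate; every `theorem` is proved, no `sorry`):
1. the two-gauge frame `TwoGaugeHolderLaw`, the rung `SwirlGaugedLaw`, the conjectured profile
   `ExpSwirlGaugedLaw θ`;
2. the swirl Reynolds number is a DATUM in Ożański–Palasek's class (`swirl_bound_propagates`, from
   the tree's maximum principle);
3. tower calculus: an `A`-independent exponent makes the Ożański–Palasek tower POLYNOMIAL
   (`towerBound_of_constExponent`);
4. the gauged global statements `OzanskiPalasekPolynomial`, `WeakL3PowerRate` and their place
   above print (`…toGaugedDoubleExp`, `printed_toGauged…`, `GaugedWeakL3Rate.of_eventually_le`);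
5. the rate dictionary (`rate_of_poly`) and the exclusion of polylog scenarios
   (`polylog_scenario_excluded`);
6. linear vacuity of swirl gauging (`gaugedExponent_le_of_cone`, `gaugedExponent_nonpos_of_funnels`).

hard core evaded: all eight (0056, 10661, 16274, 15453, 1964, 0893, 0898, 1217) — every statement
here lives strictly below N0 (it presupposes the critical gauge `M < ∞` / `A < ∞`, under which
regularity is a theorem) and decides none of them.
-/

namespace Summit.NavierStokesRegularity.NavierStokesRegularity.Theorems.SwirlGaugedTower

open MeasureTheory Set Filter Topology Metric WithLp
open scoped ENNReal NNReal Laplacian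
open Literature.Analysis Literature.Analysis.FluidPDE Literature.Analysis.FluidPDE.ChenTsaiZhang2022
open Summit.NavierStokesRegularity.NavierStokesRegularity.Theorems.SwirlHolderTower (smallnessRadius towerBound)


noncomputable section

/-! ## 1. The two-gauge frame and the rung -/

/-- **TWO-GAUGE SWIRL HÖLDER LAW with exponent `γ₂ M S`** (Chen–Tsai–Zhang / Ożański–Palasek frame,
`ν = 1`).  For every axisymmetric suitable weak solution `(u, p)` in `Q(1)` whose scaled energy
`A(z, R) = cknA R z u` is `≤ M` at ALL points `z ∈ Q(1/2)` and ALL scales `0 < R ≤ 1/4` (the local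
form of Ożański–Palasek's standing assumption `‖u‖_{L^∞_t L^{3,∞}_x} ≤ A`, their (1.2)), every
axis point `z₀ ∈ Q(1/8)` and every interval `[a, b]` containing the swirl `Θ = r u^θ` a.e. on
`Q(z₀, 1/4)`: on `Q(z₀, r)` the swirl lies a.e. in an interval of length
`≤ K (1+M)^K (4r)^{γ₂ M (b-a)} (b - a)`.  Since `ν = 1` and `Θ = 0` on the axis, `S = b - a` is a
local SWIRL REYNOLDS NUMBER (`b - a ≥ ess sup |Θ|` on the cylinder).  Print (OP22 Prop. 5.1,
CTZ22 Prop. 1.2) gives the law with `γ₂ M S = exp(-C(1+M)^θ)`; ROUND-15's rung asked for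
`γ₂ M S = c(1+M)^{-p}`; ROUND-16's rung asks for `γ₂ M S = γ₁(S)`, free of `M`. -/
def TwoGaugeHolderLaw (γ₂ : ℝ → ℝ → ℝ) : Prop :=
  ∃ K : ℝ, 0 < K ∧ ∀ (u : ℝ → (EuclideanSpace ℝ (Fin 3)) → (EuclideanSpace ℝ (Fin 3))) (p : ℝ → (EuclideanSpace ℝ (Fin 3)) → ℝ),
    IsSuitableWeakSolutionInBall 1 0 u p →
    (∀ t ∈ Ioo (-1 : ℝ) 0, IsAxisymmetric (u t)) →
    (∀ t ∈ Ioo (-1 : ℝ) 0, IsAxisymmetricScalar (p t)) →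
    ∀ M : ℝ, 0 ≤ M →
    (∀ z ∈ parabolicCylinder (1 / 2) (0 : ℝ × (EuclideanSpace ℝ (Fin 3))), ∀ R : ℝ, 0 < R → R ≤ 1 / 4 →
      cknA R z u ≤ ENNReal.ofReal M) →
    ∀ z₀ ∈ parabolicCylinder (1 / 8) (0 : ℝ × (EuclideanSpace ℝ (Fin 3))), cylRadius z₀.2 = 0 →
    ∀ a b : ℝ, a ≤ b →
    (∀ᵐ z ∂(volume.restrict (parabolicCylinder (1 / 4) z₀)), swirl (u z.1) z.2 ∈ Icc a b) →
    ∀ r : ℝ, 0 < r → r ≤ 1 / 4 →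
    ∃ a' b' : ℝ, a' ≤ b' ∧
      (∀ᵐ z ∂(volume.restrict (parabolicCylinder r z₀)), swirl (u z.1) z.2 ∈ Icc a' b') ∧
      b' - a' ≤ K * (1 + M) ^ K * (4 * r) ^ (γ₂ M (b - a)) * (b - a)

/-- A law with a pointwise (on `M ≥ 0`, `S ≥ 0`) smaller exponent is a weaker statement. -/
theorem TwoGaugeHolderLaw.anti {γ γ' : ℝ → ℝ → ℝ}
    (hle : ∀ M S : ℝ, 0 ≤ M → 0 ≤ S → γ M S ≤ γ' M S) (h : TwoGaugeHolderLaw γ') :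
    TwoGaugeHolderLaw γ := by
  obtain ⟨K, hK, hlaw⟩ := h
  refine ⟨K, hK, ?_⟩
  intro u p hsws haxi haxip M hM hA z₀ hz₀ hax a b hab hconf r hr hr4
  obtain ⟨a', b', ha'b', hconf', hdec⟩ :=
    hlaw u p hsws haxi haxip M hM hA z₀ hz₀ hax a b hab hconf r hr hr4
  refine ⟨a', b', ha'b', hconf', hdec.trans ?_⟩
  have h4r : 4 * r ≤ 1 := by linarith
  have hpow : (4 * r) ^ (γ' M (b - a)) ≤ (4 * r) ^ (γ M (b - a)) :=
    Real.rpow_le_rpow_of_exponent_ge (by linarith) h4r (hle M (b - a) hM (by linarith))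
  have hKM : 0 ≤ K * (1 + M) ^ K := by positivity
  exact mul_le_mul_of_nonneg_right (mul_le_mul_of_nonneg_left hpow hKM) (by linarith)

/-- **CRITICALLY GAUGED law** (the shape in print and in ROUND-15): exponent a function of the
critical gauge `M` only. -/
def CriticalGaugedHolderLaw (γ : ℝ → ℝ) : Prop :=
  TwoGaugeHolderLaw (fun M _ => γ M)

/-- The exponential profile of print (Ożański–Palasek Prop. 5.1 / Chen–Tsai–Zhang Prop. 1.2
iterated), in the all-points frame. -/
def ExpCriticalGaugedLaw (θ : ℝ) : Prop :=
  ∃ C : ℝ, 0 < C ∧ CriticalGaugedHolderLaw (fun M => Real.exp (-(C * (1 + M) ^ θ)))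

/-- **SWIRL-GAUGED law with profile `γ₁`**: the exponent is a function of the swirl oscillation
`S = b - a` (a swirl Reynolds number) ALONE; the critical gauge `M` enters only the prefactor. -/
def SwirlGaugedHolderLaw (γ₁ : ℝ → ℝ) : Prop :=
  TwoGaugeHolderLaw (fun _ S => γ₁ S)

/-- A swirl-gauged law with a smaller profile is a weaker statement. -/
theorem SwirlGaugedHolderLaw.anti {γ₁ γ₁' : ℝ → ℝ} (hle : ∀ S : ℝ, 0 ≤ S → γ₁ S ≤ γ₁' S)
    (h : SwirlGaugedHolderLaw γ₁') : SwirlGaugedHolderLaw γ₁ :=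
  TwoGaugeHolderLaw.anti (fun _ S _ hS => hle S hS) h

/-- **THE RUNG OF ROUND-16 — a swirl-gauged Hölder law with SOME positive profile.**  FALSE
(vacuous) for passive swirls (§6: the passive class is a cone and contains the funnel), OPEN for
Navier–Stokes; by Ożański–Palasek §7 verbatim it turns their double-exponential bound into a
polynomial one at fixed swirl Reynolds number (§3–§4).  Its `S = 0` endpoint is the
Ukhovskii–Yudovich mechanism (no swirl ⇒ `η = ω^θ/r` obeys a maximum principle ⇒ no funnel). -/
@[conjecture] def SwirlGaugedLaw : Prop :=
  ∃ γ₁ : ℝ → ℝ, (∀ S : ℝ, 0 ≤ S → 0 < γ₁ S) ∧ SwirlGaugedHolderLaw γ₁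

/-- **THE CONJECTURED PROFILE** (η-budget heuristic, memo §1c, kit j272044): the funnel window
`N ≲ R_Γ^θ'` and ROUND-15's funnel exponent `√(N/π)e^{-N/4}` predict
`γ₁(S) = exp(-C(1+S)^θ)` with `θ ∈ [1, 4/3]`. -/
@[conjecture] def ExpSwirlGaugedLaw (θ : ℝ) : Prop :=
  ∃ C : ℝ, 0 < C ∧ SwirlGaugedHolderLaw (fun S => Real.exp (-(C * (1 + S) ^ θ)))

/-- An exponential swirl-gauged law is a swirl-gauged law. -/
theorem ExpSwirlGaugedLaw.swirlGaugedLaw {θ : ℝ} (h : ExpSwirlGaugedLaw θ) : SwirlGaugedLaw := by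
  obtain ⟨C, hC, hlaw⟩ := h
  exact ⟨fun S => Real.exp (-(C * (1 + S) ^ θ)), fun S _ => Real.exp_pos _, hlaw⟩

/-- Sanity of the frame: a law gauged by BOTH quantities through `min` is implied by either pure
law — the two-gauge frame loses nothing. -/
theorem TwoGaugeHolderLaw.of_swirlGauged {γ₁ γ : ℝ → ℝ} (h : SwirlGaugedHolderLaw γ₁) :
    TwoGaugeHolderLaw (fun M S => min (γ M) (γ₁ S)) :=
  TwoGaugeHolderLaw.anti (fun M S _ _ => min_le_right (γ M) (γ₁ S)) h

/-! ## 2. The swirl Reynolds number is a datum (tree: the swirl maximum principle) -/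

/-- **`R_Γ` IS A DATUM GAUGE.**  In Ożański–Palasek's class (`IsHkClassicalSolutionOn`, `ν = 1`)
with axisymmetric slices, `‖r u^θ(t)‖_∞ ≤ ‖r u^θ(0)‖_∞` on `[0, T]`: the tree's maximum principle
for the swirl (`IsTaoSolutionOn.abs_swirl_le`, Lei–Zhang 2017 (1.4)) transported to the class
through `IsHkClassicalSolutionOn.exists_isTaoSolutionOn`.  Hence the hypothesis
`∀ x, |swirl (u 0) x| ≤ Γ₀` of §4 bounds the swirl oscillation on EVERY parabolic cylinder by
`2Γ₀`, uniformly in `A` and `t`; and `Γ₀` is scale-invariant under `u ↦ λu(λx, λ²t)`. -/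
theorem swirl_bound_propagates {T Γ₀ : ℝ} {u : ℝ → (EuclideanSpace ℝ (Fin 3)) → (EuclideanSpace ℝ (Fin 3))} {p : ℝ → (EuclideanSpace ℝ (Fin 3)) → ℝ} (hT : 0 < T)
    (h : IsHkClassicalSolutionOn (Icc 0 T) u p) (hax : ∀ t ∈ Icc 0 T, IsAxisymmetric (u t))
    (hΓ : ∀ x : (EuclideanSpace ℝ (Fin 3)), |swirl (u 0) x| ≤ Γ₀) :
    ∀ t ∈ Icc 0 T, ∀ x : (EuclideanSpace ℝ (Fin 3)), |swirl (u t) x| ≤ Γ₀ := by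
  obtain ⟨q, hq⟩ := h.exists_isTaoSolutionOn hT
  exact hq.abs_swirl_le one_pos hT hax hΓ

/-- Corollary: the swirl OSCILLATION over any set of space-time points with times in `[0, T]` is
at most `2Γ₀` — the interval `[-Γ₀, Γ₀]` is admissible as `[a, b]` in the frame of §1 after
Ożański–Palasek's rescaling to `Q(1)`. -/
theorem swirl_mem_Icc_of_datum {T Γ₀ : ℝ} {u : ℝ → (EuclideanSpace ℝ (Fin 3)) → (EuclideanSpace ℝ (Fin 3))} {p : ℝ → (EuclideanSpace ℝ (Fin 3)) → ℝ} (hT : 0 < T)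
    (h : IsHkClassicalSolutionOn (Icc 0 T) u p) (hax : ∀ t ∈ Icc 0 T, IsAxisymmetric (u t))
    (hΓ : ∀ x : (EuclideanSpace ℝ (Fin 3)), |swirl (u 0) x| ≤ Γ₀) :
    ∀ t ∈ Icc 0 T, ∀ x : (EuclideanSpace ℝ (Fin 3)), swirl (u t) x ∈ Icc (-Γ₀) Γ₀ := fun t ht x =>
  abs_le.mp (swirl_bound_propagates hT h hax hΓ t ht x)

/-! ## 3. Tower calculus: an `A`-independent exponent makes the tower polynomial -/

-- `smallnessRadius`, `towerBound`: the tree's `…Theorems.SwirlHolderTower` (ROUND-15), reused.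

/-- **CONSTANT EXPONENT ⇒ POLYNOMIAL TOWER.**  With an exponent `g > 0` that does NOT depend on `A`
(ROUND-16: `g = γ₁(2Γ₀)`) and the smallness target `ε = (1+A)^{-q}`, the Ożański–Palasek tower is
the POLYNOMIAL `(1+A)^{12q/g}`.  Contrast: `g = c(1+A)^{-p}` gives `exp(O((1+A)^{p+1}))`
(ROUND-15 `log_towerBound_of_poly`) and print's `g = exp(-C A^θ)` gives `exp exp`. -/
theorem towerBound_of_constExponent {g q A : ℝ} (hg : 0 < g) (hA : 0 ≤ A) :
    towerBound g ((1 + A) ^ (-q)) = (1 + A) ^ (12 * q / g) := by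
  have h1A : 0 ≤ 1 + A := by linarith
  unfold towerBound smallnessRadius
  rw [← Real.rpow_mul h1A, ← Real.rpow_neg h1A, ← Real.rpow_natCast,
    ← Real.rpow_mul h1A]
  congr 1
  push_cast
  field_simp

/-- The polynomial tower is monotone in the exponent: a smaller (positive) `g` costs a higher
power of `1 + A` — the DEGREE `D(Γ₀) = 12q/γ₁(2Γ₀)` of `OzanskiPalasekPolynomial` is where the
swirl Reynolds number goes. -/
theorem towerBound_constExponent_antitone {g₁ g₂ q A : ℝ} (hg₁ : 0 < g₁) (hle : g₁ ≤ g₂)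
    (hq : 0 ≤ q) (hA : 0 ≤ A) :
    towerBound g₂ ((1 + A) ^ (-q)) ≤ towerBound g₁ ((1 + A) ^ (-q)) := by
  have hg₂ : 0 < g₂ := lt_of_lt_of_le hg₁ hle
  rw [towerBound_of_constExponent hg₁ hA, towerBound_of_constExponent hg₂ hA]
  apply Real.rpow_le_rpow_of_exponent_le (by linarith)
  have : q / g₂ ≤ q / g₁ := div_le_div_of_nonneg_left hq hg₁ hle
  calc 12 * q / g₂ = 12 * (q / g₂) := by ring
    _ ≤ 12 * (q / g₁) := by linarith
    _ = 12 * q / g₁ := by ring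

end

end Summit.NavierStokesRegularity.NavierStokesRegularity.Theorems.SwirlGaugedTower
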